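import Mathlib

/-!
# PneNP / OverlapGapAlgebra — crux `SolvableImpliesStableSection` (stmt-PneNP-2463):
# the TWO-WAY REPAIR block (4a/·) — the scalar inequalities of the weight recursion

Support for crux `stmt-PneNP-2463` (`Summit.PneNP.PneNP.Theses.OverlapGapAlgebra.SolvableImpliesStableSection`):
the f-free block "bounded-round two-way repair with one-round memory gives stable sections for every
`ν > 0` up to `α ≤ 2^k/(4k)`".  Write `A_d(s)` for the total weight of the locally valid codes of
`TS d` with a childless root slot (unique if the root code is odd) and root ROUND `s` (codes `2s`,
`2s+1`) — up to the factor `#Inst`, the expected number of injective witness trees of the clauses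
flipping a variable at round `s`.  Every such root is recent (the two-way rule has no dead clauses), so
from `…TwoWayRepairWeightStep(Odd)`, `A_{d+1}(s) ≤ m·k·2^{-k}·(A_d(s-1)/n)·[(1+U/n)^{k-1} + k(U/n)^{k-2}]`
with `U ≤ ∑_{s'<s} A_d(s')`, whence:

* `sissW_exp34`, `sissW_num_bracket`, `sissW_num_core` — `e^{3/4} ≤ 2.2`; for `k ≥ 3` and
  `0 ≤ u ≤ 3/(4k)`: `(1+u)^{k-1} + k·u^{k-2} ≤ 8/3`; the scalar induction step;
* `sissW_mono_recent`, `sissW_mono_odd` — monotonicity of the two one-step bounds in the weight sums;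
  (the decay itself, `sissW_weight_decay`, is in `…TwoWayRepairWeightBound`).
No definitions (all objects are hypotheses); axioms `propext`, `Classical.choice`, `Quot.sound`.
-/

set_option linter.dupNamespace false -- `Summit.PneNP.PneNP.…`: summit = sub-problem (D-0017)

namespace Summit.PneNP.PneNP.Theorems

open Finset
open scoped Classical

section WeightNum

variable {m k n : ℕ}

/-- `e^{3/4} ≤ 2.2` (as `e^3 < 2.72^3 < 2.2^4`). -/
theorem sissW_exp34 : Real.exp (3 / 4) ≤ 22 / 10 := by
  by_contra hcon
  push Not at hcon
  have h4 : (22 / 10 : ℝ) ^ 4 < Real.exp (3 / 4) ^ 4 := pow_lt_pow_left₀ hcon (by norm_num) (by norm_num)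
  have hexp : Real.exp (3 / 4) ^ 4 = Real.exp 1 ^ 3 := by
    rw [← Real.exp_nat_mul, ← Real.exp_nat_mul]; norm_num
  rw [hexp] at h4
  have h1 := Real.exp_one_lt_d9
  have h3 : Real.exp 1 ^ 3 < (2.7182818286 : ℝ) ^ 3 :=
    pow_lt_pow_left₀ h1 (Real.exp_pos 1).le (by norm_num)
  norm_num at h4 h3
  linarith

/-- **The bracket bound.** For `k ≥ 3` and `0 ≤ u ≤ 3/(4k)`: `(1+u)^{k-1} + k·u^{k-2} ≤ 8/3`. -/
theorem sissW_num_bracket (k : ℕ) (hk : 3 ≤ k) (u : ℝ) (hu0 : 0 ≤ u) (hu : u ≤ 3 / (4 * (k : ℝ))) :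
    (1 + u) ^ (k - 1) + k * u ^ (k - 2) ≤ 8 / 3 := by
  have hk0 : (0 : ℝ) < k := by exact_mod_cast (show 0 < k by omega)
  rcases Nat.lt_or_ge k 4 with hk3 | hk4
  · -- `k = 3`: `(1+u)² + 3u` with `u ≤ 1/4`
    have hk3' : k = 3 := by omega
    subst hk3'
    have hu' : u ≤ 1 / 4 := by
      refine hu.trans ?_
      norm_num
    norm_num
    nlinarith
  · -- `k ≥ 4`: `(1+u)^{k-1} ≤ e^{3/4} ≤ 2.2` and `k u^{k-2} ≤ 9/(16k) ≤ 9/64`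
    have hk4R : (4 : ℝ) ≤ k := by exact_mod_cast hk4
    have hu1 : u ≤ 1 := by
      refine hu.trans ?_
      rw [div_le_one (by positivity)]
      linarith
    have hA : (1 + u) ^ (k - 1) ≤ 22 / 10 := by
      have h1 : (1 + u) ^ (k - 1) ≤ (1 + u) ^ k :=
        pow_le_pow_right₀ (by linarith) (Nat.sub_le k 1)
      have h2 : (1 + u) ^ k ≤ Real.exp (3 / 4) := by
        have hle : 1 + u ≤ Real.exp u := by
          have := Real.add_one_le_exp u
          linarith
        calc (1 + u) ^ k ≤ (Real.exp u) ^ k := pow_le_pow_left₀ (by linarith) hle k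
          _ = Real.exp (k * u) := (Real.exp_nat_mul _ k).symm
          _ ≤ Real.exp (3 / 4) := by
              rw [Real.exp_le_exp]
              calc (k : ℝ) * u ≤ k * (3 / (4 * k)) := mul_le_mul_of_nonneg_left hu hk0.le
                _ = 3 / 4 := by field_simp
      exact h1.trans (h2.trans sissW_exp34)
    have hB : (k : ℝ) * u ^ (k - 2) ≤ 9 / 64 := by
      have hsplit : u ^ (k - 2) = u ^ 2 * u ^ (k - 4) := by
        rw [← pow_add]; congr 1; omega
      have hu4 : u ^ (k - 4) ≤ 1 := pow_le_one₀ hu0 hu1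
      have hu2 : u ^ 2 ≤ (3 / (4 * (k : ℝ))) ^ 2 := pow_le_pow_left₀ hu0 hu 2
      calc (k : ℝ) * u ^ (k - 2) = k * (u ^ 2 * u ^ (k - 4)) := by rw [hsplit]
        _ ≤ k * ((3 / (4 * (k : ℝ))) ^ 2 * 1) := by
            refine mul_le_mul_of_nonneg_left ?_ hk0.le
            exact mul_le_mul hu2 hu4 (pow_nonneg hu0 _) (by positivity)
        _ = 9 / (16 * k) := by field_simp; ring
        _ ≤ 9 / 64 := by
            rw [div_le_div_iff₀ (by positivity) (by norm_num)]
            linarith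
    linarith

/-- `(2/3)^{s-1} = (3/2)·(2/3)^s` for `s ≥ 1`. -/
theorem sissW_theta_pow_pred (s : ℕ) (hs : 1 ≤ s) :
    (2 / 3 : ℝ) ^ (s - 1) = (3 / 2) * (2 / 3 : ℝ) ^ s := by
  obtain ⟨t, rfl⟩ := Nat.exists_eq_add_of_le hs
  rw [Nat.add_sub_cancel_left, pow_add, pow_one, ← mul_assoc]
  norm_num

/-- **The scalar induction step.** With `D = m 2^{-k}/n`, `k·D ≤ 1/4`, a recent weight
`a ≤ D·(2/3)^{s-1}` and a lower weight `0 ≤ u ≤ 3/(4k)` (`k ≥ 3`, `s ≥ 1`):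
`M k 2^{-k} a (1+u)^{k-1} + M k k 2^{-k} a u^{k-2} ≤ M 2^{-k} (2/3)^s`. -/
theorem sissW_num_core (k s : ℕ) (hk : 3 ≤ k) (hs : 1 ≤ s) (M D a u : ℝ) (hM : 0 ≤ M) (hD : 0 ≤ D)
    (hkD : (k : ℝ) * D ≤ 1 / 4) (ha : a ≤ D * (2 / 3 : ℝ) ^ (s - 1))
    (hu0 : 0 ≤ u) (hu : u ≤ 3 / (4 * (k : ℝ))) :
    M * k * (1 / 2 : ℝ) ^ k * a * (1 + u) ^ (k - 1) + M * k * k * (1 / 2 : ℝ) ^ k * a * u ^ (k - 2)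
      ≤ M * (1 / 2 : ℝ) ^ k * (2 / 3 : ℝ) ^ s := by
  have hk0 : (0 : ℝ) < k := by exact_mod_cast (show 0 < k by omega)
  have hbr := sissW_num_bracket k hk u hu0 hu
  have hbr0 : 0 ≤ (1 + u) ^ (k - 1) + k * u ^ (k - 2) := by positivity
  rw [sissW_theta_pow_pred s hs] at ha
  have hP : 0 ≤ M * (1 / 2 : ℝ) ^ k * (2 / 3 : ℝ) ^ s := by positivity
  calc M * k * (1 / 2 : ℝ) ^ k * a * (1 + u) ^ (k - 1) + M * k * k * (1 / 2 : ℝ) ^ k * a * u ^ (k - 2)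
      = M * k * (1 / 2 : ℝ) ^ k * a * ((1 + u) ^ (k - 1) + k * u ^ (k - 2)) := by ring
    _ ≤ M * k * (1 / 2 : ℝ) ^ k * (D * (3 / 2 * (2 / 3 : ℝ) ^ s)) * (8 / 3) := by
        apply mul_le_mul (mul_le_mul_of_nonneg_left ha (by positivity)) hbr hbr0 (by positivity)
    _ = M * (1 / 2 : ℝ) ^ k * (2 / 3 : ℝ) ^ s * ((k * D) * 4) := by ring
    _ ≤ M * (1 / 2 : ℝ) ^ k * (2 / 3 : ℝ) ^ s * ((1 / 4 : ℝ) * 4) :=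
        mul_le_mul_of_nonneg_left (mul_le_mul_of_nonneg_right hkD (by norm_num)) hP
    _ = M * (1 / 2 : ℝ) ^ k * (2 / 3 : ℝ) ^ s := by ring

/-- Monotonicity of the recent-root bound in its two weight sums. -/
theorem sissW_mono_recent (k : ℕ) (M n R A U V : ℝ) (hM : 0 ≤ M) (hn : 0 < n) (hR0 : 0 ≤ R)
    (hRA : R ≤ A) (hU0 : 0 ≤ U) (hUV : U ≤ V) :
    M * (R / n) * (1 + U / n) ^ (k - 1) ≤ M * (A / n) * (1 + V / n) ^ (k - 1) := by
  have h1 : R / n ≤ A / n := div_le_div_of_nonneg_right hRA hn.le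
  have h2 : 1 + U / n ≤ 1 + V / n := by linarith [div_le_div_of_nonneg_right hUV hn.le]
  have h3 : 0 ≤ 1 + U / n := by linarith [div_nonneg hU0 hn.le]
  have hA0 : 0 ≤ A / n := div_nonneg (hR0.trans hRA) hn.le
  exact mul_le_mul (mul_le_mul_of_nonneg_left h1 hM) (pow_le_pow_left₀ h3 h2 _)
    (pow_nonneg h3 _) (mul_nonneg hM hA0)

/-- Monotonicity of the odd-root bound in its two weight sums. -/
theorem sissW_mono_odd (k : ℕ) (M n R A U V : ℝ) (hM : 0 ≤ M) (hn : 0 < n) (hR0 : 0 ≤ R)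
    (hRA : R ≤ A) (hU0 : 0 ≤ U) (hUV : U ≤ V) :
    M * (R / n) * (U / n) ^ (k - 2) ≤ M * (A / n) * (V / n) ^ (k - 2) := by
  have h1 : R / n ≤ A / n := div_le_div_of_nonneg_right hRA hn.le
  have h2 : U / n ≤ V / n := div_le_div_of_nonneg_right hUV hn.le
  have h3 : 0 ≤ U / n := div_nonneg hU0 hn.le
  have hA0 : 0 ≤ A / n := div_nonneg (hR0.trans hRA) hn.le
  exact mul_le_mul (mul_le_mul_of_nonneg_left h1 hM) (pow_le_pow_left₀ h3 h2 _)
    (pow_nonneg h3 _) (mul_nonneg hM hA0)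

end WeightNum

end Summit.PneNP.PneNP.Theorems
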